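import Summits.CriticalPhenomena.PercolationContinuityZ3.Theorems.FK.InfiniteVolumeDLRCondExp
import Summits.CriticalPhenomena.PercolationContinuityZ3.Theorems.FK.InfiniteVolumeDLRKernelComparison
import HarnessLib

/-!
# FK-continuity transplant, FO-06/FO-10 (infinite-volume structure): every DLR random-cluster measure carried by
# lattice configurations satisfies the free/wired sandwich `FKGibbs`, `0 ≤ p ≤ 1` — Grimmett 2006, Thm. (4.34)(b) eq. (4.35)

Registered R80 (cell INBOX l.5895, 2026-08-23); registry row FO-10b-g407k; label KCM-E (coordinator fk-4 g175).
Cell `fk-continuity` (bschramm), FO-10b lineage; support file for the FK-continuity transplant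
(`--supports stmt-CriticalPhenomena-4575`); builds on p205010 (kernel theorem, internal audit signed; external expert
review pending). No named facts, no definitions, no sorries, standard axioms. Banked infinite-volume structure; not an
END-STATE dependency of the cell (not consumed by `_r3`); it says nothing about FH / TP_FK or continuity at `p_c`.

* `cylEvent_inter_eq_of_determinedBy`, `IsDLRRandomCluster.real_inter_eq_setIntegral_sum` —
  for `P ∈ R_{p,q}`, an event `A` determined by `E_Λ` and `H ∈ 𝒯_Λ`: `P(A ∩ H) = ∫_H ∑_{η ∈ A} φ^ξ_{Λ,p,q}(η) P(dξ)`
  (the DLR equation on cylinders, `InfiniteVolumeDLRCondExp.lean`, summed over the patterns of `A`);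
* **`IsDLRRandomCluster.fkGibbs_of_mem_Icc`** — for `0 ≤ p ≤ 1` (closed interval), `q ≥ 1` and `P ∈ R_{p,q}`
  with `P`-a.s. `ω ⊆ E(ℤ^d)`: `FKGibbs d p q P`, i.e. `φ⁰_{Λ,p,q}(A)·P(H) ≤ P(A ∩ H) ≤ φ¹_{Λ,p,q}(A)·P(H)` for every
  finite region `Λ`, increasing `A` determined by `E_Λ` and local outside information `H` — so every `FKGibbs`
  theorem of the cell applies to the whole class `R_{p,q}` (Def. (4.29)), not only to box limits. Row FO-10a's
  `DLRSandwich.lean` proves this for `0 < p < 1` (`IsDLRRandomCluster.fkGibbs`) by the box-kernel route; this file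
  is the second proof through Lemma (4.14) on the finite graph `(Λ, E_Λ)` (`InfiniteVolumeDLRKernelComparison.lean`)
  and includes the degenerate parameters `p ∈ {0, 1}`.

## References

* G. Grimmett, *The Random-Cluster Model*, Springer 2006: Def. (4.29) eq. (4.30), Lemma (4.13), Lemma (4.14)(b),
  Thm. (4.34)(b) eq. (4.35). [Grimmett2006]
-/

noncomputable section

open Finset MeasureTheory Set

namespace Summit.CriticalPhenomena.PercolationContinuityZ3.Theorems.FK

open Literature.Probability.Percolation Literature.Probability.LatticeModels

variable {d : ℕ} {p q : ℝ} {P : Measure (BondConfig (Site d))}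

/-- On a cylinder of `E_Λ`, an event determined by `E_Λ` is decided by the pattern. [folklore] -/
theorem cylEvent_inter_eq_of_determinedBy {Λ : Finset (Site d)} {A : Set (BondConfig (Site d))}
    (hA : DeterminedBy A ↑(edgesIn (zdGraph d) Λ)) (η : Finset (Sym2 (Site d)))
    [Decidable ((↑η : BondConfig (Site d)) ∈ A)] :
    cylEvent (edgesIn (zdGraph d) Λ) η ∩ A =
      if (↑η : BondConfig (Site d)) ∈ A then cylEvent (edgesIn (zdGraph d) Λ) η else ∅ := by
  have key : ∀ ω ∈ cylEvent (edgesIn (zdGraph d) Λ) η, (ω ∈ A ↔ (↑η : BondConfig (Site d)) ∈ A) := by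
    intro ω hω
    refine (determinedBy_iff _ _).1 hA ω ↑η ?_
    ext e
    simp only [Set.mem_inter_iff, Finset.mem_coe]
    constructor
    · rintro ⟨he, heU⟩; exact ⟨(mem_cylEvent_iff.1 hω e heU).1 he, heU⟩
    · rintro ⟨he, heU⟩; exact ⟨(mem_cylEvent_iff.1 hω e heU).2 he, heU⟩
  split_ifs with h
  · exact Set.inter_eq_left.2 fun ω hω => (key ω hω).2 h
  · exact Set.eq_empty_of_forall_notMem fun ω hω => h ((key ω hω.1).1 hω.2)

namespace IsDLRRandomCluster

/-- **The DLR decomposition of `P(A ∩ H)` along the patterns of `E_Λ`**: for `P ∈ R_{p,q}`, an event `A`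
determined by `E_Λ` and an outside event `H ∈ 𝒯_Λ`,
`P(A ∩ H) = ∫_H ∑_{η ⊆ E_Λ, η ∈ A} φ^ξ_{Λ,p,q}(η) P(dξ)`. [cite: Grimmett2006, Def. (4.29) eq. (4.30), Lemma (4.13)] -/
theorem real_inter_eq_setIntegral_sum (hP : IsDLRRandomCluster d p q P) (hp : p ∈ Set.Icc (0 : ℝ) 1) (hq : 0 < q)
    (Λ : Finset (Site d)) {A : Set (BondConfig (Site d))} (hAm : MeasurableSet A)
    (hA : DeterminedBy A ↑(edgesIn (zdGraph d) Λ)) [DecidablePred (· ∈ A)] {H : Set (BondConfig (Site d))}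
    (hH : MeasurableSet[outsideEvents d Λ] H) :
    P.real (A ∩ H) = ∫ ξ in H, ∑ η ∈ (edgesIn (zdGraph d) Λ).powerset,
      (if (↑η : BondConfig (Site d)) ∈ A then rcCondProb p q Λ ξ η else 0) ∂P := by
  classical
  haveI := hP.isProbabilityMeasure
  have hHm : MeasurableSet H := outsideEvents_le Λ _ hH
  rw [← sum_real_cylEvent_inter P (edgesIn (zdGraph d) Λ) (hAm.inter hHm)]
  rw [integral_finsetSum _ fun η hη => ?_]
  · refine Finset.sum_congr rfl fun η hη => ?_
    have hη' := Finset.mem_powerset.1 hη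
    rw [← Set.inter_assoc, cylEvent_inter_eq_of_determinedBy hA η]
    split_ifs with h
    · rw [hP.real_cylEvent_inter_eq_setIntegral hp hq Λ hη' hH]
    · rw [Set.empty_inter, measureReal_empty, integral_zero]
  · split_ifs
    · exact (integrable_rcCondProb P hp hq Λ (Finset.mem_powerset.1 hη)).integrableOn
    · exact integrableOn_zero


/-- **Grimmett 2006, (4.35) / Lemma (4.14)(b) in the cell's form: every DLR random-cluster measure carried by
lattice configurations satisfies the free/wired sandwich `FKGibbs`** (`0 ≤ p ≤ 1`, `q ≥ 1`): for every finite region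
`Λ`, increasing `A` determined by `E_Λ` and local outside information `H`,
`φ⁰_{Λ,p,q}(A) · P(H) ≤ P(A ∩ H) ≤ φ¹_{Λ,p,q}(A) · P(H)`.  Consequently every `FKGibbs` theorem of the cell applies
to the whole class `R_{p,q}`. [cite: Grimmett2006, Thm. (4.34)(b) eq. (4.35), Lemma (4.14)(b)] -/
theorem fkGibbs_of_mem_Icc (hP : IsDLRRandomCluster d p q P) (hp : p ∈ Set.Icc (0 : ℝ) 1) (hq : 1 ≤ q)
    (hlat : ∀ᵐ ω ∂P, ω ⊆ (zdGraph d).edgeSet) : FKGibbs d p q P := by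
  classical
  haveI := hP.isProbabilityMeasure
  have hq0 : 0 < q := one_pos.trans_le hq
  -- common preliminaries for a region `Λ`, an increasing `E_Λ`-event `A` and local outside information `H`
  have hprep : ∀ (Λ : Finset (Site d)) ⦃A H : Set (BondConfig (Site d))⦄ (T : Finset (Sym2 (Site d))),
      DeterminedBy A ↑(edgesIn (zdGraph d) Λ) →
      Disjoint (↑T : Set (Sym2 (Site d))) ↑(edgesIn (zdGraph d) Λ) → DeterminedBy H ↑T →
      MeasurableSet A ∧ MeasurableSet[outsideEvents d Λ] H ∧ MeasurableSet H := by
    intro Λ A H T hA hT hH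
    have hAm : MeasurableSet A := hA.measurableSet_of_finset
    have hHm : MeasurableSet H := hH.measurableSet_of_finset
    have hHo : MeasurableSet[outsideEvents d Λ] H :=
      measurableSet_cylinderEvents_of_determinedBy hHm (hH.mono hT.subset_compl_right)
    exact ⟨hAm, hHo, hHm⟩
  refine ⟨hP.isProbabilityMeasure, hlat, ?_, ?_⟩
  · intro Λ A H T hAup hA hT hH
    obtain ⟨hAm, hHo, hHm⟩ := hprep Λ T hA hT hH
    rw [hP.real_inter_eq_setIntegral_sum hp hq0 Λ hAm hA hHo]
    calc regionFreeReal d p q Λ A * P.real H = ∫ _ in H, regionFreeReal d p q Λ A ∂P := by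
          rw [setIntegral_const, smul_eq_mul, mul_comm]
      _ ≤ _ := by
          refine setIntegral_mono_on (integrable_const _).integrableOn ?_ hHm fun ξ _ => ?_
          · exact (integrable_finsetSum _ fun η hη => by
              split_ifs
              · exact integrable_rcCondProb P hp hq0 Λ (Finset.mem_powerset.1 hη)
              · exact integrable_zero _ _ _).integrableOn
          · exact regionFreeReal_le_sum_ite_rcCondProb hp hq Λ ξ hAup
  · intro Λ A H T hAup hA hT hH
    obtain ⟨hAm, hHo, hHm⟩ := hprep Λ T hA hT hH
    rw [hP.real_inter_eq_setIntegral_sum hp hq0 Λ hAm hA hHo]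
    calc _ ≤ ∫ _ in H, regionWiredReal d p q Λ A ∂P := by
          refine setIntegral_mono_ae ?_ (integrable_const _).integrableOn ?_
          · exact (integrable_finsetSum _ fun η hη => by
              split_ifs
              · exact integrable_rcCondProb P hp hq0 Λ (Finset.mem_powerset.1 hη)
              · exact integrable_zero _ _ _).integrableOn
          · filter_upwards [hlat] with ξ hξ
            exact sum_ite_rcCondProb_le_regionWiredReal hp hq Λ hξ hAup
      _ = regionWiredReal d p q Λ A * P.real H := by rw [setIntegral_const, smul_eq_mul, mul_comm]

end IsDLRRandomCluster

end Summit.CriticalPhenomena.PercolationContinuityZ3.Theorems.FK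

end
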